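import Mathlib.Algebra.Polynomial.Eval.Defs
import Literature.Computability.Cryptography.ShorFactoring
import Literature.Computability.Cryptography.QuantumCircuitProofs
import Literature.Computability.Cryptography.QubitRegisterCliffordTProofs
import Literature.Computability.Complexity.NondeterministicProofs
import HarnessLib

/-!
# Shor's factoring theorem, FBQP form: assembly (family PQC)

Third companion file of `Literature/Computability/Cryptography/Shor.lean`. It assembles the
named facts `Literature.Computability.Cryptography.isQSolvable_factoring` and `Literature.Computability.Cryptography.factoring_mem_FBQP` (Shor 1997, §5:
`Nat.primeFactorsList`, transported to Boolean strings, is in `FBQP`; the two are definitionally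
equivalent, `factoring_mem_FBQP_iff_isQSolvable_factoring`) from named facts of the tree, the
proved classical reduction of `ShorFactoring.lean`, and two closure principles of the
poly-time-uniform Clifford+T circuit model, vendored here as named facts.

## Content

* **The order oracle as a language.** `orderBitLang`: canonical encodings of `((x, n), i)` on
  Shor's promise (`1 < n`, `gcd(x, n) = 1`) with bit `i` of `ord_n(x)` set (empty off the
  promise). `orderBitLang_mem_BQP_of` (proved): it is in `BQP`, from Shor's order-finding
  theorem `Shor1997_orderFinding_isQSolvable` (`ShorProofs`) by the tree's deterministic
  classical wrap `isQSolvable_classicalWrap` (pre-processor `ordPre`, the first pair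
  projection, proved polynomial-time here: `ordPre_mem_FP`, by the projection machine
  `boolUnpairFstLift` of `NondeterministicProofs` around Mathlib's identity machine;
  post-processor `ordPost` with the programming fact `ordPost_mem_FP`) and decision-from-search
  `mem_BQP_of_isQSolvable_bit` (`ShorProofs`; consumes the Born-rule fact
  `QCircuit.outputPMF_apply`, discharged in `QuantumCircuitProofs`, and the unitarity fact
  `cliffordT_isUnitary`, discharged in `QubitRegisterCliffordTProofs`; both are used from
  there). The post-processor recovers the order from a
  *non-self-delimiting* prefix (`orderFromPrefix`, `orderFromPrefix_eq`: the first positive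
  prefix-candidate `c` with `x^c ≡ 1 (mod n)` is the order — candidates are multiples of the
  order and a candidate on at most `|bin r|` bits is `< 2r`; no `gcd` and no coprimality test
  are needed, `orderFromPrefix_eq_zero_of_not_coprime`).
* **Two closure principles** (named facts, cited): `isQSolvable_of_mem_BQP_oracle` — a `BQP`
  oracle inside a bounded-error quantum search for an extension-closed relation can be removed
  (Bennett–Bernstein–Brassard–Vazirani 1997, Thm. 4.14 / Cor. 4.15 `BQP^BQP = BQP`, with
  explicit slack `δ`; the workspace of the tidy deciders is appended to the output); and
  `kernelProb_ge_uniformProb_of_mem_FPRel` — a polynomial-time *oracle* computation on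
  `⟨input, coins⟩` is simulated, coins included, by a uniform family with oracle gates
  (Bernstein–Vazirani 1997, proof of Thm. 8.3, relativised; the oracle-free, decision special
  case is `Literature.Computability.QuantumComplexity.uniformReversibleSimulation` of `BQPProofs`).
* **Two programming facts**: `ordPost_mem_FP` (above) and `shorClassical_mem_FPRel` — the
  classical part `Shor1997.shorClassical` of `ShorFactoring` is in `FP` relative to the
  order-bit oracle.
* **Assembly** (proved): `isQSolvable_factoring_of_orderBitLang`,
  `isQSolvable_factoring_of`, `factoring_mem_FBQP_of` — Shor's theorem in FBQP form follows from
  the facts listed, the success bound `Shor1997.shorClassical_success` (`≥ 3/4 = 2/3 + 1/12`)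
  supplying the slack. The remaining hypotheses of `factoring_mem_FBQP_of` are exactly:
  `isQSolvable_classicalWrap` and `Shor1997_orderFinding_isQSolvable` (`ShorProofs`), and the
  four facts of this file (`ordPost_mem_FP`, `isQSolvable_of_mem_BQP_oracle`,
  `kernelProb_ge_uniformProb_of_mem_FPRel`, `shorClassical_mem_FPRel`).

## Sources

* P. W. Shor, *Polynomial-time algorithms for prime factorization and discrete logarithms on a
  quantum computer*, SIAM J. Comput. 26 (1997) 1484–1509, §5 (pp. 15–19 of arXiv:quant-ph/
  9508027v2).
* C. H. Bennett, E. Bernstein, G. Brassard, U. Vazirani, *Strengths and weaknesses of quantum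
  computing*, SIAM J. Comput. 26 (1997) 1510–1523 (= arXiv:quant-ph/9701001), §4: Thm. 4.13
  (boosting), Thm. 4.14 (tidy subroutine: final superposition `|x⟩|L(x)⟩` with squared
  magnitude `≥ 1 - ε`, time polynomial in `log 1/ε`), Cor. 4.15 (`BQP^BQP = BQP`).
* E. Bernstein, U. Vazirani, *Quantum complexity theory*, SIAM J. Comput. 26 (1997)
  1411–1473, Thm. 8.3 (`BPP ⊆ BQP`: Fourier transform on the coin track, then a synchronised
  reversible simulation of the deterministic machine) and §8.3 (oracle QTMs).
* S. Arora, B. Barak, *Computational Complexity* (CUP 2009), §3.4 (oracle machines), Lemma 10.10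
  and Cor. 10.11 (reversible simulation, `BPP ⊆ BQP`).

## Design choices

* The subroutine is passed through a *language* oracle (`orderBitLang`), because the tree's
  oracle gates (`QuantumCircuit`) and relativised classes (`IsQSolvableRel`, `FPRel`) query
  languages / string functions, not promise search problems; the promise of order finding is
  handled by making the language empty off the promise and letting `shorClassical` query only
  on it (its `orderOf` calls are all on-promise, see `ShorFactoring`).
* `isQSolvable_of_mem_BQP_oracle` carries an explicit slack `δ > 0` above `2/3`: the printed
  subroutine theorem replaces oracle calls up to an error that is only made small, not zero, and
  a general search relation cannot be re-amplified; with `IsQSolvableRel`'s bare `2/3` the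
  statement would be stronger than what the source proves.
* `kernelProb_ge_uniformProb_of_mem_FPRel` is stated as an inequality for every event `S`
  ("the output has a prefix in `S`" is implied by "`G ⟨x, c⟩ ∈ S`"), the form consumed here and
  the form the reversible simulation yields (the measured string is `G ⟨x, c⟩` followed by the
  other wires).
* All facts are threaded as hypotheses `(h : X)` of the assembly theorems, per the tree's
  convention (`FACT_mem_BQP_of` in `ShorProofs`), so that discharging them closes
  `isQSolvable_factoring` / `factoring_mem_FBQP` by one application.
-/

noncomputable section

namespace Literature.Computability.Cryptography

open _root_.Computability Nat Complexity

/-! ### `factoring_mem_FBQP` is `isQSolvable_factoring` -/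

/-- The two FBQP forms of Shor's theorem in `Shor.lean` agree definitionally:
`FBQP = {f | IsQSolvable fun x => {y | f x <+: y}}`. [cite: Shor1997SICOMP, §5 (factoring in FBQP)] -/
theorem factoring_mem_FBQP_iff_isQSolvable_factoring :
    factoring_mem_FBQP ↔ isQSolvable_factoring :=
  Iff.rfl

/-! ### The order oracle as a language -/

/-- The Boolean encoding of order queries `((x, n), i)` (iterated `pairBool` of binary
encodings). [Shor 1997, §5] [folklore] -/
abbrev orderQueryEncoding : Encoding ((ℕ × ℕ) × ℕ) Bool :=
  (encodingNatBool.pairBool encodingNatBool).pairBool encodingNatBool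

/-- **The order-bit language**: canonical encodings of triples `((x, n), i)` on Shor's promise
(`1 < n`, `gcd(x, n) = 1`) such that bit `i` of the order of `x` modulo `n` is `1`; the
bit-graph of the order-finding function, empty off the promise. Its membership in `BQP` is the
language form of Shor's order-finding theorem (`orderBitLang_mem_BQP_of`).
[cite: Shor1997SICOMP, §5 p.15 (order finding)] -/
def orderBitLang : Language Bool :=
  {w | ∃ x n i : ℕ, w = orderQueryEncoding.encode ((x, n), i) ∧ 1 < n ∧ x.Coprime n ∧
    (orderOf (x : ZMod n)).testBit i = true}

/-- The membership bit of `orderBitLang` (by computing the order; used in statements and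
proofs only). [folklore] -/
def orderBit (w : List Bool) : Bool :=
  match orderQueryEncoding.decode w with
  | none => false
  | some ((x, n), i) => decide (orderQueryEncoding.encode ((x, n), i) = w) && decide (1 < n) &&
      decide (x.Coprime n) && (orderOf (x : ZMod n)).testBit i

/-- `orderBit` is the membership bit of `orderBitLang`. [folklore] -/
theorem orderBit_eq_true_iff (w : List Bool) : orderBit w = true ↔ w ∈ orderBitLang := by
  constructor
  · intro h
    unfold orderBit at h
    split at h
    · exact absurd h Bool.false_ne_true
    · rename_i x n i hdec
      simp only [Bool.and_eq_true, decide_eq_true_eq] at h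
      exact ⟨x, n, i, h.1.1.1.symm, h.1.1.2, h.1.2, h.2⟩
  · rintro ⟨x, n, i, rfl, hn, hcop, hbit⟩
    unfold orderBit
    rw [orderQueryEncoding.decode_encode]
    have hcop' : Nat.gcd x n = 1 := hcop
    simp [hn, Nat.Coprime, hcop', hbit]

/-- The classical pre-processor of an order query: the first pair projection
`w ↦ (boolUnpair w).1`, taking the canonical encoding of `((x, n), i)` to the encoding
`encodeOrderInstance x n` of the input of Shor's order-finding algorithm (`ordPre_encode`); on
other strings its value is irrelevant (the post-processor answers `false` there).
[Arora–Barak 2009, §0.1 (pairing)] [folklore] -/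
def ordPre (w : List Bool) : List Bool :=
  (boolUnpair w).1

/-- On a canonical query the pre-processor returns the order-finding instance.
[folklore] -/
theorem ordPre_encode (x n i : ℕ) :
    ordPre (orderQueryEncoding.encode ((x, n), i)) = encodeOrderInstance x n := by
  change (boolUnpair (boolPair _ _)).1 = _
  rw [boolUnpair_boolPair]
  rfl

/-- Evaluation of an `ℕ`-polynomial is monotone (a private copy of the folklore lemma
`Literature.Computability.Complexity.TM2Iter.eval_mono` / `Literature.Computability.Complexity.natPoly_eval_mono`, neither of which is in this
file's import closure). [folklore] -/
private theorem natPoly_eval_mono (r : Polynomial ℕ) {a b : ℕ} (hab : a ≤ b) :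
    r.eval a ≤ r.eval b := by
  induction r using Polynomial.induction_on' with
  | add p q hp hq => simp only [Polynomial.eval_add]; exact Nat.add_le_add hp hq
  | monomial n c =>
    simp only [Polynomial.eval_monomial]
    exact Nat.mul_le_mul_left c (Nat.pow_le_pow_left hab n)

/-- **The pre-processor is polynomial time** (proved): run Mathlib's identity machine
(`Turing.idComputableInPolyTime`, through `PolyTimeComputable.id`) behind the pair-projection
front end `boolUnpairFstLift` of `NondeterministicProofs` (which feeds a machine the first
component `(boolUnpair w).1` of its input, in `|w| + 3` extra steps).
[Arora–Barak 2009, Claim 2.4 (ignore the second component), §1.2] [folklore] -/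
theorem ordPre_mem_FP : ordPre ∈ FP := by
  obtain ⟨p, M, hM⟩ := PolyTimeComputable.id (Γ₀ := Bool) (id : List Bool → List Bool)
  refine ⟨p + (Polynomial.X + 3), boolUnpairFstLift M, fun w => ?_⟩
  have h : M.OutputsWithin (boolUnpair w).1 (boolUnpair w).1 (p.eval (boolUnpair w).1.length) :=
    hM (boolUnpair w).1
  change (boolUnpairFstLift M).OutputsWithin w (boolUnpair w).1
    (Polynomial.eval w.length (p + (Polynomial.X + 3)))
  refine (outputsWithin_boolUnpairFstLift M h).mono ?_
  simp only [Polynomial.eval_add, Polynomial.eval_X, Polynomial.eval_ofNat]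
  have := Literature.Computability.Cryptography.natPoly_eval_mono p (length_boolUnpair_fst_le w)
  omega

/-- Recovering the order from the measured string. The order-finding family writes
`encodeNat r` as a *prefix* of its output, and `encodeNat` is not self-delimiting; so scan the
prefixes of `y` by increasing length and return the first *candidate* `c = decodeNat (y.take ℓ)`
with `0 < c` and `x ^ c ≡ 1 (mod n)` (`0` if there is none). Every candidate is a multiple of
the order `r`, a candidate read off at most `|encodeNat r|` bits is `< 2r` and hence equals `r`,
and the prefix `encodeNat r` itself is a candidate: the scan returns `r` (`orderFromPrefix_eq`).
A candidate exists only if `x` is a unit modulo `n` (`orderFromPrefix_eq_zero_of_not_coprime`),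
so the post-processor needs neither a `gcd` nor a coprimality test — one modular
exponentiation per prefix (the form programmed for `ordPost_mem_FP`). [folklore] -/
def orderFromPrefix (x n : ℕ) (y : List Bool) : ℕ :=
  (((List.range (y.length + 1)).map fun ℓ => decodeNat (y.take ℓ)).find?
    fun c => decide (0 < c ∧ x ^ c ≡ 1 [MOD n])).getD 0

/-- A positive numeral on `L` bits is at least `2 ^ (L - 1)` (its leading bit is `1`).
[folklore] -/
theorem two_pow_length_le_posNum (p : PosNum) : 2 ^ ((encodePosNum p).length - 1) ≤ (p : ℕ) := by
  induction p with
  | one => simp [encodePosNum]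
  | bit0 p ih =>
    have hl : 0 < (encodePosNum p).length := List.length_pos_iff.2 (encodePosNum_nonempty p)
    have e : (encodePosNum p).length = (encodePosNum p).length - 1 + 1 := by omega
    simp only [encodePosNum, List.length_cons, Nat.add_sub_cancel, PosNum.cast_bit0]
    rw [e, pow_succ]
    omega
  | bit1 p ih =>
    have hl : 0 < (encodePosNum p).length := List.length_pos_iff.2 (encodePosNum_nonempty p)
    have e : (encodePosNum p).length = (encodePosNum p).length - 1 + 1 := by omega
    simp only [encodePosNum, List.length_cons, Nat.add_sub_cancel, PosNum.cast_bit1]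
    rw [e, pow_succ]
    omega

/-- For `0 < r`, `encodeNat r` is nonempty and `2 ^ (|encodeNat r| - 1) ≤ r`. [folklore] -/
theorem two_pow_length_encodeNat_le {r : ℕ} (hr : 0 < r) :
    0 < (encodeNat r).length ∧ 2 ^ ((encodeNat r).length - 1) ≤ r := by
  unfold encodeNat encodeNum
  cases h : (r : Num) with
  | zero =>
    exfalso
    have := congrArg (fun m : Num => (m : ℕ)) h
    simp at this; omega
  | pos p =>
    have hp : (p : ℕ) = r := by
      have := congrArg (fun m : Num => (m : ℕ)) h
      simpa using this.symm
    simp only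
    rw [← hp]
    exact ⟨List.length_pos_iff.2 (encodePosNum_nonempty p), two_pow_length_le_posNum p⟩

/-- A positive exponent with `x ^ c ≡ 1 (mod n)` makes `x` a unit modulo `n`. [folklore] -/
theorem coprime_of_pow_modEq_one {x n c : ℕ} (hc : 0 < c) (h : x ^ c ≡ 1 [MOD n]) :
    x.Coprime n := by
  obtain ⟨d, rfl⟩ := Nat.exists_eq_add_of_lt hc
  rw [zero_add, pow_succ, mul_comm] at h
  exact Nat.coprime_of_mul_modEq_one _ h

/-- Off the promise the scan finds nothing: if `x` is not a unit modulo `n`, no candidate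
passes, and `orderFromPrefix x n y = 0`. [folklore] -/
theorem orderFromPrefix_eq_zero_of_not_coprime {x n : ℕ} (hx : ¬ x.Coprime n) (y : List Bool) :
    orderFromPrefix x n y = 0 := by
  unfold orderFromPrefix
  rw [List.find?_eq_none.2]
  · rfl
  · intro c _ hc
    simp only [decide_eq_true_eq] at hc
    exact hx (coprime_of_pow_modEq_one hc.1 hc.2)

/-- **Correctness of the recovery**: for `x` coprime to `n`, if `encodeNat (ord_n x)` is a
prefix of `y` then `orderFromPrefix x n y = ord_n x`. [folklore] -/
theorem orderFromPrefix_eq {x n : ℕ} (hx : x.Coprime n) {y : List Bool}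
    (hy : encodeNat (orderOf (x : ZMod n)) <+: y) :
    orderFromPrefix x n y = orderOf (x : ZMod n) := by
  set r := orderOf (x : ZMod n) with hr
  have hrpos : 0 < r := by
    rw [hr, ← ZMod.coe_unitOfCoprime x hx, orderOf_units, orderOf_pos_iff]
    exact isOfFinOrder_of_finite _
  set L := (encodeNat r).length with hL
  obtain ⟨w, hw⟩ := hy
  have hLy : L ≤ y.length := by rw [← hw, List.length_append]; omega
  have htakeL : y.take L = encodeNat r := by rw [← hw]; simp [hL]
  -- the candidate predicate and the candidates
  set Q : ℕ → Bool := fun ℓ => decide (0 < decodeNat (y.take ℓ) ∧ x ^ decodeNat (y.take ℓ) ≡ 1 [MOD n])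
    with hQ
  have hmult : ∀ ℓ, Q ℓ = true → r ∣ decodeNat (y.take ℓ) := by
    intro ℓ hℓ
    simp only [hQ, decide_eq_true_eq] at hℓ
    have h1 : (x : ZMod n) ^ decodeNat (y.take ℓ) = 1 := by
      have := hℓ.2
      rw [← ZMod.natCast_eq_natCast_iff, Nat.cast_pow, Nat.cast_one] at this
      exact this
    exact orderOf_dvd_of_pow_eq_one h1
  have hQL : Q L = true := by
    simp only [hQ, htakeL, Computability.decode_encodeNat, decide_eq_true_eq]
    refine ⟨hrpos, ?_⟩
    rw [← ZMod.natCast_eq_natCast_iff, Nat.cast_pow, Nat.cast_one, hr, pow_orderOf_eq_one]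
  -- a candidate on at most `L` bits equals `r`
  have hsmall : ∀ ℓ, ℓ ≤ L → Q ℓ = true → decodeNat (y.take ℓ) = r := by
    intro ℓ hℓ hq
    rcases Nat.lt_or_ge ℓ L with hlt | hge
    · have hpos : 0 < decodeNat (y.take ℓ) := by
        simp only [hQ, decide_eq_true_eq] at hq; exact hq.1
      obtain ⟨k, hk⟩ := hmult ℓ hq
      have hlt2 : decodeNat (y.take ℓ) < 2 * r := by
        have h1 := decodeNat_lt (y.take ℓ)
        have h2 : (y.take ℓ).length = ℓ := List.length_take_of_le (by omega)
        rw [h2] at h1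
        have h3 : 2 ^ (ℓ + 1) ≤ 2 ^ L := Nat.pow_le_pow_right (by norm_num) hlt
        obtain ⟨hL0, h4⟩ := two_pow_length_encodeNat_le hrpos
        rw [← hL] at hL0 h4
        have h5 : 2 ^ L = 2 * 2 ^ (L - 1) := by
          rw [← pow_succ']; congr 1; omega
        omega
      rw [hk] at hpos hlt2 ⊢
      have hk1 : k = 1 := by
        rcases k with _ | _ | k
        · simp at hpos
        · rfl
        · nlinarith
      rw [hk1, mul_one]
    · have : ℓ = L := le_antisymm hℓ hge
      rw [this, htakeL, Computability.decode_encodeNat]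
  -- the scan stops at the first candidate, which is on at most `L` bits
  unfold orderFromPrefix
  rw [List.find?_map]
  change ((List.range (y.length + 1)).find? Q |>.map fun ℓ => decodeNat (y.take ℓ)).getD 0 = r
  obtain ⟨j, hj⟩ : ∃ j, (List.range (y.length + 1)).find? Q = some j := by
    rw [← Option.isSome_iff_exists, List.find?_isSome]
    exact ⟨L, List.mem_range.2 (by omega), hQL⟩
  rw [hj, Option.map_some, Option.getD_some]
  rw [List.find?_range_eq_some] at hj
  obtain ⟨hQj, -, hmin⟩ := hj
  have hjL : j ≤ L := by
    by_contra hcon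
    have := hmin L (by omega)
    rw [hQL] at this
    exact Bool.noConfusion this
  exact hsmall j hjL hQj

/-- The classical post-processor of an order query. Input `⟨w, y⟩` (`boolPair`): the query `w`
and the measured output `y` of the order-finding family run on `ordPre w`; output one bit:
`false` unless `w` is the canonical encoding of some `((x, n), i)` with `1 < n`, in which case
bit `i` of the recovered order `orderFromPrefix x n y` (which is `0` off the promise
`gcd(x, n) = 1`, so no coprimality test is made). [folklore] -/
def ordPost (z : List Bool) : List Bool :=
  match orderQueryEncoding.decode (boolUnpair z).1 with
  | none => [false]
  | some ((x, n), i) =>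
    if orderQueryEncoding.encode ((x, n), i) = (boolUnpair z).1 ∧ 1 < n then
      [(orderFromPrefix x n (boolUnpair z).2).testBit i]
    else [false]

/-- The order-finding relation of `Shor1997_orderFinding_isQSolvable`, named. [Shor 1997, §5]
[cite: Shor1997SICOMP, §5 p.15 (order finding)] -/
def orderRel (w : List Bool) : Set (List Bool) :=
  {y | ∀ x n : ℕ, w = encodeOrderInstance x n → 1 < n → x.Coprime n →
    encodeNat (orderOf (x : ZMod n)) <+: y}

/-- **Correctness of the post-processor**: if `y` solves the order-finding instance `ordPre w`,
then `ordPost ⟨w, y⟩ = [orderBit w]`. [folklore] -/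
theorem ordPost_boolPair (w y : List Bool) (hy : y ∈ orderRel (ordPre w)) :
    ordPost (boolPair w y) = [orderBit w] := by
  unfold ordPost orderBit
  simp only [boolUnpair_boolPair]
  rcases hdec : orderQueryEncoding.decode w with _ | ⟨⟨x, n⟩, i⟩
  · rfl
  · simp only
    by_cases h : orderQueryEncoding.encode ((x, n), i) = w ∧ 1 < n
    · obtain ⟨hw, hn⟩ := h
      by_cases hcop : x.Coprime n
      · have hpre : ordPre w = encodeOrderInstance x n := by rw [← hw]; exact ordPre_encode x n i
        have hr := orderFromPrefix_eq hcop (hy x n hpre hn hcop)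
        have hcop' : Nat.gcd x n = 1 := hcop
        simp [hw, hn, Nat.Coprime, hcop', hr]
      · have hcop' : ¬ Nat.gcd x n = 1 := hcop
        simp [hw, hn, Nat.Coprime, hcop', orderFromPrefix_eq_zero_of_not_coprime hcop]
    · rw [if_neg h]
      simp only [not_and_or] at h
      rcases h with h | h <;> simp [h]

/-- **Programming fact**: the post-processor `ordPost` (parse the query and check that it is
canonical; for the prefixes of `y` by increasing length decode a candidate and test
`x ^ c ≡ 1 (mod n)` by modular exponentiation, stopping at the first success; read one bit) is
polynomial-time computable. [Arora–Barak 2009, §1.2; Shor 1997, §5 (classical post-processing)] [folklore] -/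
def ordPost_mem_FP : Prop :=
  ordPost ∈ FP

/-- **The order-bit language is in `BQP`**, from Shor's order-finding theorem
(`Shor1997_orderFinding_isQSolvable`) by classical wrapping (`isQSolvable_classicalWrap` with
the proved `ordPre_mem_FP` and the programming fact `ordPost_mem_FP`) and decision-from-search
(`mem_BQP_of_isQSolvable_bit`, fed with the discharged Born-rule fact
`QCircuit.outputPMF_apply_holds` and the discharged unitarity fact `cliffordT_isUnitary_holds`).
[cite: Shor1997SICOMP, §5 p.15 (order finding in quantum polynomial time)] -/
theorem orderBitLang_mem_BQP_of (hwrap : isQSolvable_classicalWrap)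
    (hpost : ordPost_mem_FP) (hShor : Shor1997_orderFinding_isQSolvable) :
    orderBitLang ∈ BQP := by
  have h1 := hwrap ordPre ordPost ordPre_mem_FP hpost hShor
  have h2 : IsQSolvable fun w => {z | [orderBit w] <+: z} := by
    refine h1.mono fun w z hz => ?_
    obtain ⟨y, hy, hz⟩ := hz
    rw [ordPost_boolPair w y hy] at hz
    exact hz
  exact mem_BQP_of_isQSolvable_bit (fun _ _ => QCircuit.outputPMF_apply_holds)
    cliffordT_isUnitary_holds orderBit_eq_true_iff h2

/-! ### The two closure principles (named facts) -/

/-- **`BQP` subroutines inside bounded-error quantum search** (Bennett–Bernstein–Brassard–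
Vazirani 1997, Thm. 4.14: a `BQP` machine can be made *tidy* — final superposition
`|x⟩|L(x)⟩|0…0⟩` with squared magnitude `≥ 1 - ε` in time polynomial in `log 1/ε`, the
workspace being returned to `0` but still present — "since these tidy BQP machines can be
safely used as subroutines", Cor. 4.15: `BQP^BQP = BQP`; circuit form over the tree's oracle
gates). Search-problem form with explicit slack, for relations closed under extension of the
output string (the tree's convention, cf. `isQSolvable_classicalWrap`: `IsQSolvable` measures
*all* wires, and the simulation appends the workspace wires of the tidy deciders to those of
the oracle family, so only such relations — e.g. prefix relations `{y | f x <+: y}` — are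
insensitive to the extra wires): if `A ∈ BQP` and a poly-time uniform Clifford+T family *with
oracle gates for `A`* outputs a string in `R x` with probability `≥ 2/3 + δ` (`δ > 0`), then
replacing each oracle gate by a tidy amplified decider of `A` (its ancillas appended) gives an
oracle-free uniform family whose output — the old wires followed by the returned workspace —
lies in `R x` with probability `≥ 2/3`, i.e. `IsQSolvable R`. (The slack `δ` absorbs the
simulation error; for bare `2/3` the conclusion would need re-amplification of `R`,
unavailable for general relations.)
[cite: BennettBernsteinBrassardVazirani1997, Thm. 4.14 and Cor. 4.15 (BQP^BQP = BQP)] -/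
def isQSolvable_of_mem_BQP_oracle : Prop :=
  ∀ (A : Language Bool) (R : List Bool → Set (List Bool)) (F : QCircuitFamily cliffordT) (δ : ℝ),
    (∀ x, ∀ y ∈ R x, ∀ z, y <+: z → z ∈ R x) →
    A ∈ BQP → F.IsUniform → 0 < δ → (∀ x, 2 / 3 + δ ≤ F.kernelProb A x (R x)) → IsQSolvable R

/-- **Coins and reversible simulation of polynomial-time oracle computations** (Bernstein–
Vazirani 1997, proof of Thm. 8.3 `BPP ⊆ BQP`, relativised: Hadamard gates on `q(n)` coin wires,
then a synchronised reversible simulation of the deterministic oracle machine, its queries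
becoming oracle gates; Arora–Barak 2009, Lemma 10.10 / Cor. 10.11; Bennett–Bernstein–Brassard–
Vazirani 1997, §4 first paragraph: "any classical deterministic computation can be carried
out reversibly so that only the input and the answer remain", oracle invocations included).
In the tree's model an oracle gate `QGate.oracle ℓ e` has a fixed number `ℓ` of query wires,
while the machine's queries have data-dependent lengths `≤ q(n)`: at each query step one
oracle gate per length `ℓ ≤ q(n)` is applied, the register of every unused length holding a
fixed dummy query whose (deterministic) answer bit is uncomputed by a second application, so
no controlled oracle gates are needed.
Statement over the tree's models: if `G ∈ FP^A` (`FPRel (Oracle.ofLanguage A)`, G01 oracle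
algorithms) and `q` is a polynomial, there is a poly-time uniform Clifford+T family with oracle
gates for `A` which, on input `x`, outputs a string with prefix `G ⟨x, c⟩` for a uniformly
random `c ∈ {0,1}^{q(|x|)}`: for every event `S`,
`P_c[G ⟨x, c⟩ ∈ S] ≤ P[output has a prefix in S]`.
[cite: BernsteinVazirani1997SICOMP, Thm. 8.3 (proof; relativised via §8.3 oracle QTMs)] -/
def kernelProb_ge_uniformProb_of_mem_FPRel : Prop :=
  ∀ (A : Language Bool) (G : List Bool → List Bool) (q : Polynomial ℕ),
    G ∈ FPRel (Oracle.ofLanguage A) →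
      ∃ F : QCircuitFamily cliffordT, F.IsUniform ∧ ∀ (x : List Bool) (S : Set (List Bool)),
        uniformProb (q.eval x.length) {c | G (boolPair x c) ∈ S} ≤
          F.kernelProb A x {y | ∃ s ∈ S, s <+: y}

/-- **Programming fact**: the classical part of Shor's algorithm, `Shor1997.shorClassical`, is
computable in polynomial time *relative to the order-bit oracle*: an oracle algorithm parses
`⟨x, c⟩`, runs the `64 (|x|+1)²` rounds of the work-list machine (parity test, integer roots for
perfect powers, `gcd`s, modular exponentiation — Shor 1997, §5: "it is easy to check whether
`n` is even or a prime power in polynomial time classically"), obtaining each needed order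
`ord_m(x)` (only for `1 < m`, `gcd(x, m) = 1`, where the oracle answers truthfully) by
`size m` bit queries `((x, m), i)`, and sorts. [cite: Shor1997SICOMP, §5 pp.15–16 (classical parts of the algorithm are polynomial time)] -/
def shorClassical_mem_FPRel : Prop :=
  Shor1997.shorClassical ∈ FPRel (Oracle.ofLanguage orderBitLang)

/-! ### Assembly -/

/-- The coin polynomial `64 (X + 1)³` of the classical part. [folklore] -/
def coinPoly : Polynomial ℕ := 64 * (Polynomial.X + 1) ^ 3

/-- The coin polynomial evaluates to the coin length `Shor1997.coinLen` of `ShorFactoring`.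
[folklore] -/
theorem coinPoly_eval (L : ℕ) : coinPoly.eval L = Shor1997.coinLen L := by
  simp [coinPoly, Shor1997.coinLen_eq]

/-- **Assembly of Shor's theorem, FBQP form, from the order-bit language.** If the order-bit
language is in `BQP`, then — by the coin/reversible-simulation principle applied to the
classical part `shorClassical ∈ FP^{orderBit}` (success probability `≥ 3/4 = 2/3 + 1/12` by
`Shor1997.shorClassical_success`) and the `BQP`-subroutine principle (the target relation
`{y | factorisation <+: y}` is closed under extension, `List.IsPrefix.trans`) — the prime
factorisation is in `FBQP` (`isQSolvable_factoring`). [cite: Shor1997SICOMP, §5 (factoring in quantum polynomial time)] -/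
theorem isQSolvable_factoring_of_orderBitLang (hsub : isQSolvable_of_mem_BQP_oracle)
    (hsim : kernelProb_ge_uniformProb_of_mem_FPRel) (hprog : shorClassical_mem_FPRel)
    (hA : orderBitLang ∈ BQP) : isQSolvable_factoring := by
  obtain ⟨F, hunif, hF⟩ := hsim orderBitLang Shor1997.shorClassical coinPoly hprog
  refine hsub orderBitLang _ F (1 / 12) (fun x y hy z hyz => List.IsPrefix.trans hy hyz) hA hunif
    (by norm_num) fun x => ?_
  have h := hF x {encodingListNatBool.encode (decodeNat x).primeFactorsList}
  have hs := Shor1997.shorClassical_success x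
  rw [← coinPoly_eval] at hs
  simp only [Set.mem_singleton_iff, exists_eq_left] at h
  linarith

/-- **Assembly of Shor's theorem, FBQP form** (`isQSolvable_factoring`, equivalently
`factoring_mem_FBQP`), from: deterministic classical
wrapping `isQSolvable_classicalWrap` with the programming fact `ordPost_mem_FP`; the
`BQP`-subroutine principle `isQSolvable_of_mem_BQP_oracle`; the coin/reversible-simulation
principle `kernelProb_ge_uniformProb_of_mem_FPRel` with the programming fact
`shorClassical_mem_FPRel`; and Shor's order-finding theorem
`Shor1997_orderFinding_isQSolvable`. Everything else — the randomised reduction, its recursion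
to a complete factorisation and its probability analysis (`ShorFactoring`), the pre-processor,
the Born rule (`QuantumCircuitProofs`), unitarity of the gate set
(`QubitRegisterCliffordTProofs`) — is proved. [cite: Shor1997SICOMP, §5 (factoring in quantum polynomial time)] -/
theorem isQSolvable_factoring_of (hwrap : isQSolvable_classicalWrap)
    (hpost : ordPost_mem_FP) (hsub : isQSolvable_of_mem_BQP_oracle)
    (hsim : kernelProb_ge_uniformProb_of_mem_FPRel) (hprog : shorClassical_mem_FPRel)
    (hShor : Shor1997_orderFinding_isQSolvable) : isQSolvable_factoring :=
  isQSolvable_factoring_of_orderBitLang hsub hsim hprog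
    (orderBitLang_mem_BQP_of hwrap hpost hShor)

/-- The same assembly for the `FBQP`-membership form `factoring_mem_FBQP`.
[cite: Shor1997SICOMP, §5 (factoring in quantum polynomial time)] -/
theorem factoring_mem_FBQP_of (hwrap : isQSolvable_classicalWrap)
    (hpost : ordPost_mem_FP) (hsub : isQSolvable_of_mem_BQP_oracle)
    (hsim : kernelProb_ge_uniformProb_of_mem_FPRel) (hprog : shorClassical_mem_FPRel)
    (hShor : Shor1997_orderFinding_isQSolvable) : factoring_mem_FBQP :=
  factoring_mem_FBQP_iff_isQSolvable_factoring.2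
    (isQSolvable_factoring_of hwrap hpost hsub hsim hprog hShor)

end Literature.Computability.Cryptography

end
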